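import Summits.ResolutionOfSingularities.ResolutionOfSingularities.Theses.RuledResidues
import HarnessLib

/-!
# Empty corner E1 of line `contracted-divisor`: the local endomorphism must NOT be onto
(crux `RuledResidues.NonRuledDivisors`, stmt-ResolutionOfSingularities-18075)

The hunt `stub_contractedDivisorGerm` asks for a ring automorphism `τ` of `K` inducing a local
ENDOmorphism of `R_P` (`τ r = a/s`, `s ∉ P`, `r ∈ P ↔ a ∈ P`), a valuation ring `D ⊇ R_P` contracted into
`P` (`τ P ⊆ 𝔪_D`) and an ESCAPING UNIT (`∃ s ∈ P ∩ Dˣ`).  If `τ` also maps `P·R_P` ONTO `P·R_P` — typed: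
every `q ∈ P` is `τ(r)·s/s'` with `r ∈ P`, `s, s' ∉ P` — then the escaping unit `q` itself lies in
`τ(P)·R_Pˣ ⊆ 𝔪_D`, contradiction.  So a contracted-divisor germ needs `τ(R_P) ⊊ R_P`: `Spec τ` is a
birational self-map that is NOT a local isomorphism at `P` (for normal `R_P`, by Zariski's main theorem it
contracts a positive-dimensional subvariety into `P` — which is what `D` is).  This is corner (E1) of the
line card `Cruxes/NonRuledDivisors/Lines/contracted-divisor.md`, companion of the engine-A corners
`orbitGerm_engineA_false_of_surjOn` / `…_of_normal_of_integral` of line `automorphism-orbit`.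
`k`, DVR-ness, finite type and non-ruledness play no role: the statement is over a bare subring.
-/

-- dupNamespace: the problem namespace legitimately repeats the summit name
set_option linter.dupNamespace false

namespace Summit.ResolutionOfSingularities.ResolutionOfSingularities.Theorems

/-- **E1: no escaping unit when `τ` is onto the maximal ideal of `R_P`.**  If every `q ∈ P` has the form
`τ(r)·s/s'` with `r ∈ P` and `s, s' ∉ P`, and `D ⊇ S` is a valuation ring in which elements of `S ∖ P` are
units and `τ P ⊆ 𝔪_D`, then NO element of `P` is a unit of `D`.  Hence the data of
`stub_contractedDivisorGerm` force `τ(P R_P) R_P ⊊ P R_P`, i.e. `τ` is not onto `R_P`. [folklore] -/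
theorem contractedDivisor_no_escapingUnit_of_surjOn {K : Type*} [Field K] (S : Subring K)
    (P : Ideal S) (τ : K ≃+* K)
    (hsurj : ∀ q : S, q ∈ P → ∃ r s s' : S, r ∈ P ∧ s ∉ P ∧ s' ∉ P ∧
      τ (r : K) * (s : K) = (q : K) * (s' : K))
    (D : ValuationSubring K) (hunit : ∀ s : S, s ∉ P → (s : K) ∉ D.nonunits)
    (hSD : S ≤ D.toSubring)
    (hcon : ∀ r : S, r ∈ P → τ (r : K) ∈ D.nonunits) :
    ¬ ∃ q : S, q ∈ P ∧ (q : K) ∉ D.nonunits := by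
  rintro ⟨q, hqP, hqunit⟩
  obtain ⟨r, s, s', hr, hs, hs', heq⟩ := hsurj q hqP
  -- `s'` is a unit of `D`, so `q·s' ∈ 𝔪_D` forces `q ∈ 𝔪_D`
  have hs'D : (s' : K) ∈ D := hSD s'.2
  have hsD : (s : K) ∈ D := hSD s.2
  have hs'val : D.valuation (s' : K) = 1 :=
    le_antisymm ((D.valuation_le_one_iff _).mpr hs'D)
      (not_lt.mp fun h => hunit s' hs' ((D.mem_nonunits_iff).mpr h))
  have hsval : D.valuation (s : K) ≤ 1 := (D.valuation_le_one_iff _).mpr hsD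
  have hτr : D.valuation (τ (r : K)) < 1 := (D.mem_nonunits_iff).mp (hcon r hr)
  have hlhs : D.valuation (τ (r : K) * (s : K)) < 1 := by
    rw [map_mul]
    calc D.valuation (τ (r : K)) * D.valuation (s : K)
        ≤ D.valuation (τ (r : K)) * 1 := mul_le_mul_right hsval _
      _ = D.valuation (τ (r : K)) := mul_one _
      _ < 1 := hτr
  have hq : D.valuation (q : K) < 1 := by
    have := hlhs
    rw [heq, map_mul, hs'val, mul_one] at this
    exact this
  exact hqunit ((D.mem_nonunits_iff).mpr hq)

/-- The same corner phrased on the stub's data: local endomorphism + contraction + escaping unit are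
jointly INCONSISTENT with surjectivity of `τ` onto `P·R_P`. [folklore] -/
theorem contractedDivisor_not_surjOn {K : Type*} [Field K] (S : Subring K) (P : Ideal S) (τ : K ≃+* K)
    (D : ValuationSubring K) (hSD : S ≤ D.toSubring)
    (hunit : ∀ s : S, s ∉ P → (s : K) ∉ D.nonunits)
    (hcon : ∀ r : S, r ∈ P → τ (r : K) ∈ D.nonunits)
    (hesc : ∃ s : S, s ∈ P ∧ (s : K) ∉ D.nonunits) :
    ¬ ∀ q : S, q ∈ P → ∃ r s s' : S, r ∈ P ∧ s ∉ P ∧ s' ∉ P ∧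
      τ (r : K) * (s : K) = (q : K) * (s' : K) :=
  fun hsurj => contractedDivisor_no_escapingUnit_of_surjOn S P τ hsurj D hunit hSD hcon hesc

end Summit.ResolutionOfSingularities.ResolutionOfSingularities.Theorems
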